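import Summits.QuantumFields.YangMills.Theses.F4SubCurvatureDoor
import Summits.QuantumFields.YangMills.Theorems.F4SubCurvatureDoorSubCurvatureClauseAxisReduction
import Summits.QuantumFields.YangMills.Theorems.F4SubCurvatureDoorSubCurvatureClauseLatticeToAxisTwoSided
import Summits.QuantumFields.YangMills.Theorems.F4SubCurvatureDoorSubCurvatureKernelPointwiseRP
import Summits.QuantumFields.YangMills.Theorems.F4SubCurvatureDoorSubCurvatureKernelFaithfulness
import Summits.QuantumFields.YangMills.Theorems.CheckerboardTrialityHyperoctahedralRung
import Literature.MathematicalPhysics.QuantumFieldTheory.YangMillsOS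
import Literature.MathematicalPhysics.QuantumFieldTheory.SpeciesTimeReflection
import HarnessLib

/-!
# Crux `F4SubCurvatureDoor.SubCurvatureClause` ⟨stmt-QuantumFields-23763⟩ — skeleton line `rp-moebius-ladder` (card A)

CRUX-PLAN skeleton for the crux idea «rp-moebius-ladder» (ideator ym-idea-3 g24, card rev 3 `54328f44f112b957`, PASS tier B by
idea-crit-4 g11 2026-08-29T22:28:55Z / 22:39:14Z; drafted files-only by ym-idea-3 g25 for the crux-plan seat of R527-ym (a)).

THE LINE.  The sub-curvature clause `‖x‖⁸ K(x) → 0` (`x → 0`) for every continuous kernel representing an off-diagonal limit point of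
Wilson's action density along a leg scheme is ASYMPTOTIC FREEDOM of the composite two-point function.  The line types it ON THE LATTICE,
ON THE TIME AXIS, WITHOUT UNITS: the dimensionless SYMMETRISED on-axis curvature coupling `Gs(β, L, t) = (2t)⁸ · max(⟨Q^θ ; Q⟩_{2t}, ⟨Q ; Q^θ⟩_{2t})`
(`axisGs = max axisG axisG'`, both orders of the reflected pair — stub letters rev 3 (g25): the certified Sketch rev 2 letters with `axisG ↦ axisGs`,
forced by the agreed TWO-SIDED letter of `LatticeToAxis` (frs-p2 g19, easing (c) accepted by g24 22:27:46Z), since `Q^θ` is not a lattice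
translate of `Q`) obeys

* `stub_moebiusRow` (XL, THE crux; Bałaban-class renormalisation group with two composite sources, not in print): one block step toward
  the ultraviolet contracts `G` by the one-loop Möbius map `M_b(u) = u/(1 + b√u)²` inside the intrinsic weak-coupling window, up to an
  arbitrary floor `δ`;
* `stub_crossoverDecay` (L–XL, infrared residual; confinement side): past the intrinsic crossover `G > η` the coupling is eventually `≤ ε`;
* `stub_latticeToAxis` (M, soft; the agreed frs-p2 g19 letter, proved by them modulo a served olean): an eventual two-sided bound on the
  reflected pair at lattice scales `2t·a_k ≈ u` bounds `u⁸ |K(u e₀)|`.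

PROVED HERE (0 sorry outside the three stubs): the sign-free anchor-free Möbius telescope, the intrinsic crossover index and its window
lemma, the `j`-step row telescope, the PROFILE LEMMA `profile_window` (a scheme-dependent sub-subsequence along which `G ≤ ε` at every
lattice scale comparable to `u/a_k`, for all small `u` — dichotomy on the physical crossover length `ℓ_k = a_k · t_×(k)`), and the
kernel-checked composition `SubCurvatureClause_of : MoebiusRow → CrossoverDecay → LatticeToAxis → SubCurvatureClause` through the LANDED
tree theorems ✓`axisReduction` (frs-p2 g19), ✓`pointwise_rp_of_offDiagLimitAlong`, ✓`faithful_of_kernel`,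
✓`signedPerm_invariant_of_offDiagLimitAlong`.

HONEST LABEL: a skeleton; `stub_moebiusRow` is asymptotic freedom of 4-D Yang–Mills for a composite channel and is an OPEN PROBLEM;
⟨23763⟩, ⟨23036⟩ stay open; the Yang–Mills mass gap is NOT proved; no summit is proved by a line.
-/

set_option autoImplicit false

noncomputable section

open scoped SchwartzMap BigOperators
open MeasureTheory Filter Topology
open Literature.MathematicalPhysics.QuantumFieldTheory Literature.MathematicalPhysics.QuantumLattice
open Literature.MathematicalPhysics.AQFT Literature.Probability.LatticeModels
open Summit.QuantumFields.YangMills.Cruxes.OSLegsFromFemtoAndGap.DlrCollarTransfer (MomentBounds6)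
open Summit.QuantumFields.YangMills.Theorems.ROT (IsLegScheme OffDiagLimitAlong)

namespace Summit.QuantumFields.YangMills.Cruxes.SubCurvatureClause.RpMoebiusLadder

local notation "E4" => EuclideanSpace ℝ (Fin 4)

/-! ## §1 Objects (verbatim from the certified sketch, HOME `g24/Sketch.lean` rev 2 `f2bba44a686b086a`) -/

section Objects

variable {G : Type} [Group G] [TopologicalSpace G] [IsTopologicalGroup G] [CompactSpace G]
  [MeasurableSpace G] [BorelSpace G]

/-- **The on-axis dimensionless curvature coupling** `G(β, L, t) := (2t)⁸ · lCC_{β,2L+1}(Q^θ, Q, 2t)`: the connected time-correlation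
(tree `latticeConnectedCorr`) of Wilson's corner action density `Q = r.curvature.F` against its site-time-reflected variant
`Q^θ = r.curvature.timeReflect.F` at EVEN time separation `2t` on the odd torus `2L+1`, times `(2t)⁸`.  No unit map, no scheme, no
renormalisation constant. -/
def axisG (r : LatticeRep G) (β : ℝ) (L t : ℕ) : ℝ :=
  ((2 * t : ℕ) : ℝ) ^ 8 *
    latticeConnectedCorr r.ρ β (2 * L + 1) r.curvature.timeReflect.F r.curvature.F (2 * t)

/-- The MIRROR ORDER of the reflected pair, `G'(β, L, t) := (2t)⁸ · lCC_{β,2L+1}(Q, Q^θ, 2t)` — also a reflection-positive square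
(`⟨Q_{−t} · Θ₀(Q_{−t})⟩`), NOT equal to `axisG` on the lattice (`Q^θ` is not a translate of `Q`: tree `torusDensity_timeReflect`,
`reflDensity_sub_torusDensity` — the two orders differ by one backward time-difference of the electric part). -/
def axisG' (r : LatticeRep G) (β : ℝ) (L t : ℕ) : ℝ :=
  ((2 * t : ℕ) : ℝ) ^ 8 *
    latticeConnectedCorr r.ρ β (2 * L + 1) r.curvature.F r.curvature.timeReflect.F (2 * t)

/-- **The SYMMETRISED on-axis coupling** `Gs := max G G'` over the two orders of the reflected pair (stub letters rev 3, g25: forced by the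
agreed two-sided letter of `LatticeToAxis` — lattice axis domination `CurvatureKernel.AxisDominationOfForm` consumes BOTH orders). -/
def axisGs (r : LatticeRep G) (β : ℝ) (L t : ℕ) : ℝ :=
  max (axisG r β L t) (axisG' r β L t)

end Objects

/-- The one-loop **Möbius map** `M_b(u) = u / (1 + b√u)²` (`1/√(M_b u) = 1/√u + b` for `u > 0`). -/
def moebius (b u : ℝ) : ℝ := u / (1 + b * Real.sqrt u) ^ 2

/-- **Statement of `stub_moebiusRow` — C⁺ of card A** (UV; THE non-transferring stub; XL): one block step `t ↦ Λt` toward the infrared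
LOSES at least `b` in `1/√Gs` — one step toward the ultraviolet contracts the symmetrised coupling `Gs` by the Möbius map — throughout the
INTRINSIC weak-coupling window (`Gs ≤ η` at every scale `≤ Λt`), up to an ARBITRARY floor `δ > 0` reached for `β ≥ β₁(δ)` (`Λ, b, η` chosen
BEFORE `δ`; critic sharpening S1).  Letter = certified Sketch rev 2 with `axisG ↦ axisGs` (both reflection orders; rev 3, g25).  No unit map,
no pinning, no coupling of record in the statement. [cite: Balaban1989, LRYM I–II] [cite: MagnenRivasseauSeneor1993] -/
def MoebiusRow : Prop :=
  ∀ (G : Type) [Group G] [TopologicalSpace G] [IsTopologicalGroup G] [CompactSpace G],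
    IsCompactSimpleLieGroup G →
    letI : MeasurableSpace G := borel G
    haveI : BorelSpace G := ⟨rfl⟩
    ∀ r : LatticeRep G, ∃ (Λ : ℕ) (b η : ℝ), 2 ≤ Λ ∧ 0 < b ∧ 0 < η ∧
      ∀ δ : ℝ, 0 < δ → ∃ β₁ : ℝ, ∀ β : ℝ, β₁ ≤ β → ∀ (L t : ℕ), 1 ≤ t → 4 * (Λ * t) + 8 ≤ L →
        (∀ s : ℕ, 1 ≤ s → s ≤ Λ * t → axisGs r β L s ≤ η) →
          axisGs r β L t ≤ max δ (moebius b (axisGs r β L (Λ * t)))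

/-- **Statement of `stub_crossoverDecay` — card A's IR RESIDUAL** (qualitative clustering PAST THE INTRINSIC CROSSOVER; L–XL): once
the symmetrised on-axis coupling has exceeded `η` at some scale `s₀`, it is `≤ ε` at every scale `≥ M s₀`, uniformly in `β` large and
in the torus (`M` chosen after `η, ε`).  Letter = certified Sketch rev 2 with `axisG ↦ axisGs` (rev 3, g25).  Needed only because the clause
quantifies over EVERY unit map `a` (infrared-zoomed schemes). [cite: OsterwalderSeiler1978, §2] -/
def CrossoverDecay : Prop :=
  ∀ (G : Type) [Group G] [TopologicalSpace G] [IsTopologicalGroup G] [CompactSpace G],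
    IsCompactSimpleLieGroup G →
    letI : MeasurableSpace G := borel G
    haveI : BorelSpace G := ⟨rfl⟩
    ∀ (r : LatticeRep G) (η : ℝ), 0 < η → ∀ ε : ℝ, 0 < ε →
      ∃ (M : ℕ) (β₁ : ℝ), ∀ β : ℝ, β₁ ≤ β → ∀ (L s₀ s : ℕ), 1 ≤ s₀ → η < axisGs r β L s₀ →
        M * s₀ ≤ s → 4 * s + 8 ≤ L → axisGs r β L s ≤ ε

/-- **Statement of `stub_latticeToAxis` — lattice → limit ON THE AXIS** (soft, M): the AGREED LETTER of ym-line-frs-p2 g19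
(`0 ≤ B`, TWO-SIDED axis window; = their `latticeToAxis` in HOME `ym-line-frs-p2/g19/LatticeToAxisByName.lean`, token-for-token up to the
tree's `abbrev E4`; proved there as `latticeToAxis_of_axisDomination (AxisDominationOfForm OddTorusCovCauchySchwarz)` — ⧗p749306 tools +
main file, unconditional one-liner pending the hub's olean for `PencilRigidityCurvatureKernelBoundAxisDominationOfForm`): under the door's
hypotheses, an eventual bound `B ≥ 0` on BOTH orders of the on-axis lattice coupling at lattice scales `2t a_k ∈ [u(1−θ), u(1+θ)]` along the
subsequence bounds `u⁸ |K(u e₀)|` by `((1+θ)/(1−θ))⁸ B`. [cite: OsterwalderSeiler1978, §2] [cite: OS1973, §2] -/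
def LatticeToAxis : Prop :=
  ∀ (G : Type) [Group G] [TopologicalSpace G] [IsTopologicalGroup G] [CompactSpace G],
    IsCompactSimpleLieGroup G →
    letI : MeasurableSpace G := borel G
    haveI : BorelSpace G := ⟨rfl⟩
    ∀ (r : LatticeRep G) (a : ℝ → ℝ), (∀ β, 0 < a β) → Tendsto a atTop (nhds 0) →
      Cruxes.OSLegsFromFemtoAndGap.DlrCollarTransfer.MomentBounds6 G r a →
      ∀ sch : SpeciesScheme (YMSpecies G), Theorems.ROT.IsLegScheme a sch → ∀ φ : ℕ → ℕ, Tendsto φ atTop atTop →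
      ∀ S₁ : SchwingerFamily E4, Theorems.ROT.OffDiagLimitAlong r sch φ S₁ →
      ∀ K : E4 → ℝ, ContinuousOn K {x : E4 | x ≠ 0} →
      (∀ F : 𝓢((Fin 2 → E4), ℂ), IsOffDiagonal F → HasCompactSupport (F : (Fin 2 → E4) → ℂ) →
        Integrable (fun x : Fin 2 → E4 => (K (x 0 - x 1) : ℂ) * F x) ∧
          S₁ 2 F = ∫ x : Fin 2 → E4, (K (x 0 - x 1) : ℂ) * F x) →
      ∀ (u θ B : ℝ), 0 < u → 0 < θ → θ < 1 → 0 ≤ B →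
        (∀ᶠ k in atTop, ∀ t : ℕ, u * (1 - θ) ≤ 2 * t * sch.a (φ k) → 2 * t * sch.a (φ k) ≤ u * (1 + θ) →
          ((2 * t : ℕ) : ℝ) ^ 8 * latticeConnectedCorr r.ρ (sch.β (φ k)) (2 * sch.L (φ k) + 1)
              r.curvature.timeReflect.F r.curvature.F (2 * t) ≤ B ∧
          ((2 * t : ℕ) : ℝ) ^ 8 * latticeConnectedCorr r.ρ (sch.β (φ k)) (2 * sch.L (φ k) + 1)
              r.curvature.F r.curvature.timeReflect.F (2 * t) ≤ B) →
        u ^ 8 * |K (EuclideanSpace.single 0 u)| ≤ (1 + θ) ^ 8 / (1 - θ) ^ 8 * B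

/-! ## §2 The registered stubs -/

/-- **STUB (XL — THE crux of the line).** Asymptotic freedom of the reflected curvature two-point coupling, one block step, intrinsic
window, arbitrary floor. [cite: Balaban1989, LRYM I–II] -/
theorem stub_moebiusRow : MoebiusRow := by
  sorry

/-- **STUB (L–XL — infrared residual).** Clustering past the intrinsic crossover, in crossover units. [cite: OsterwalderSeiler1978, §2] -/
theorem stub_crossoverDecay : CrossoverDecay := by
  sorry

/-- **STUB (M — soft density transfer on the axis; agreed two-sided letter, closes by `exact …LatticeToAxisByName.latticeToAxis` once that
helper is accepted).** [cite: OS1973, §2] -/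
theorem stub_latticeToAxis : LatticeToAxis := by
  exact Summit.QuantumFields.YangMills.Theorems.F4SubCurvatureDoorSubCurvatureClauseLatticeToAxisTwoSided.latticeToAxis

/-! ## §3 The Möbius map: elementary lemmas and the SIGN-FREE anchor-free telescope (proved) -/

theorem moebius_nonneg {b u : ℝ} (hu : 0 ≤ u) : 0 ≤ moebius b u := by
  unfold moebius; positivity

/-- On `(-∞, 0]` the Möbius map is the identity (`√u = 0`). -/
theorem moebius_of_nonpos {b u : ℝ} (hu : u ≤ 0) : moebius b u = u := by
  unfold moebius
  rw [Real.sqrt_eq_zero'.2 hu, mul_zero, add_zero, one_pow, div_one]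

/-- `M_b` never exceeds `1/b²` (on `[0, ∞)`). -/
theorem moebius_le_inv_sq {b u : ℝ} (hb : 0 < b) (hu : 0 ≤ u) : moebius b u ≤ 1 / b ^ 2 := by
  unfold moebius
  have hs : 0 ≤ Real.sqrt u := Real.sqrt_nonneg u
  have hsq : Real.sqrt u ^ 2 = u := Real.sq_sqrt hu
  have hden : 0 < (1 + b * Real.sqrt u) ^ 2 := by positivity
  rw [div_le_div_iff₀ hden (by positivity), one_mul]
  nlinarith [sq_nonneg (b * Real.sqrt u), hsq, mul_nonneg hb.le hs]

/-- `M_b` never exceeds `1/b²` (everywhere). -/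
theorem moebius_le_inv_sq' {b : ℝ} (hb : 0 < b) (u : ℝ) : moebius b u ≤ 1 / b ^ 2 := by
  rcases le_or_gt 0 u with hu | hu
  · exact moebius_le_inv_sq hb hu
  · rw [moebius_of_nonpos hu.le]
    exact hu.le.trans (by positivity)

/-- `M_b u ≤ u` on `[0, ∞)`. -/
theorem moebius_le_self {b u : ℝ} (hb : 0 ≤ b) (hu : 0 ≤ u) : moebius b u ≤ u := by
  unfold moebius
  refine div_le_self hu ?_
  have hs : 0 ≤ b * Real.sqrt u := mul_nonneg hb (Real.sqrt_nonneg u)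
  nlinarith

/-- `M_b` is monotone on `[0, ∞)`. -/
theorem moebius_mono {b u v : ℝ} (hb : 0 ≤ b) (hu : 0 ≤ u) (huv : u ≤ v) : moebius b u ≤ moebius b v := by
  have hv : 0 ≤ v := hu.trans huv
  have hsu : 0 ≤ Real.sqrt u := Real.sqrt_nonneg u
  have hsv : 0 ≤ Real.sqrt v := Real.sqrt_nonneg v
  have hsuv : Real.sqrt u ≤ Real.sqrt v := Real.sqrt_le_sqrt huv
  have key : ∀ w : ℝ, 0 ≤ w → moebius b w = (Real.sqrt w / (1 + b * Real.sqrt w)) ^ 2 := by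
    intro w hw
    unfold moebius
    rw [div_pow, Real.sq_sqrt hw]
  rw [key u hu, key v hv]
  have hfu : 0 ≤ Real.sqrt u / (1 + b * Real.sqrt u) := by positivity
  have hf : Real.sqrt u / (1 + b * Real.sqrt u) ≤ Real.sqrt v / (1 + b * Real.sqrt v) := by
    rw [div_le_div_iff₀ (by positivity) (by positivity)]
    nlinarith [mul_nonneg hb hsu, mul_nonneg hb hsv]
  exact pow_le_pow_left₀ hfu hf 2

/-- `M_b` is monotone from anywhere into `[0, ∞)` (negative arguments are fixed points below every nonnegative value). -/
theorem moebius_mono' {b u v : ℝ} (hb : 0 ≤ b) (hv : 0 ≤ v) (huv : u ≤ v) : moebius b u ≤ moebius b v := by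
  rcases le_or_gt 0 u with hu | hu
  · exact moebius_mono hb hu huv
  · rw [moebius_of_nonpos hu.le]
    exact hu.le.trans (moebius_nonneg hv)

/-- The Möbius map shifts the AF ladder by one rung: `M_b (1/(b k)²) = 1/(b (k+1))²`. -/
theorem moebius_rung {b k : ℝ} (hb : 0 < b) (hk : 0 < k) :
    moebius b (1 / (b * k) ^ 2) = 1 / (b * (k + 1)) ^ 2 := by
  unfold moebius
  have hbk : 0 < b * k := mul_pos hb hk
  have hsq : Real.sqrt (1 / (b * k) ^ 2) = 1 / (b * k) := by
    rw [show (1 / (b * k) ^ 2 : ℝ) = (1 / (b * k)) ^ 2 by ring]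
    exact Real.sqrt_sq (by positivity)
  rw [hsq]
  field_simp

/-- **SIGN-FREE anchor-free telescoping**: `j ≥ 1` Möbius steps with floor `δ ≥ 0` bound the finest scale by `max δ (1/(b j)²)`,
WHATEVER the anchor `g j` and WITHOUT any sign information (a negative value is a fixed point of `M_b` below the floor). -/
theorem moebius_telescope {b δ : ℝ} (hb : 0 < b) (hδ : 0 ≤ δ) (g : ℕ → ℝ)
    (j : ℕ) (hj : 1 ≤ j) (hstep : ∀ i, i < j → g i ≤ max δ (moebius b (g (i + 1)))) :
    g 0 ≤ max δ (1 / (b * j) ^ 2) := by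
  suffices Q : ∀ n : ℕ, 1 ≤ n → n ≤ j → g (j - n) ≤ max δ (1 / (b * n) ^ 2) by
    simpa using Q j hj le_rfl
  intro n hn
  induction n with
  | zero => exact absurd hn (by norm_num)
  | succ m ih =>
    intro hmj
    have hi : j - (m + 1) < j := by omega
    have hstep' := hstep (j - (m + 1)) hi
    have hidx : j - (m + 1) + 1 = j - m := by omega
    rw [hidx] at hstep'
    refine hstep'.trans ?_
    rcases Nat.eq_zero_or_pos m with hm0 | hmpos
    · subst hm0
      refine max_le_max le_rfl ?_
      simpa using moebius_le_inv_sq' hb (g (j - 0))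
    · have hm1 : 1 ≤ m := hmpos
      have hb' := ih hm1 (by omega)
      have hnn : 0 ≤ max δ (1 / (b * m) ^ 2) := hδ.trans (le_max_left _ _)
      have hmono : moebius b (g (j - m)) ≤ moebius b (max δ (1 / (b * m) ^ 2)) :=
        moebius_mono' hb.le hnn hb'
      refine max_le (le_max_left _ _) (hmono.trans ?_)
      rcases le_total δ (1 / (b * m) ^ 2) with h | h
      · rw [max_eq_right h, moebius_rung hb (by exact_mod_cast hmpos)]
        push_cast
        exact le_max_right _ _
      · rw [max_eq_left h]
        exact (moebius_le_self hb.le hδ).trans (le_max_left _ _)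

/-! ## §4 The `j`-step row telescope inside the intrinsic window (proved) -/

/-- **Row telescope.**  If the Möbius row holds at every scale `t' ≥ 1` with `4Λt' + 8 ≤ N` whose window `[1, Λt']` is `η`-small, then
`j` block steps `t, Λt, …, Λʲt` inside an `η`-small window `[1, Λʲ t]` fitting the torus give `G t ≤ max δ (1/(b j)²)`. -/
theorem row_telescope {Λ : ℕ} {b η δ : ℝ} (hΛ : 1 ≤ Λ) (hb : 0 < b) (hδ : 0 ≤ δ) {g : ℕ → ℝ} {N : ℕ}
    (hrow : ∀ t : ℕ, 1 ≤ t → 4 * (Λ * t) + 8 ≤ N → (∀ s : ℕ, 1 ≤ s → s ≤ Λ * t → g s ≤ η) →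
      g t ≤ max δ (moebius b (g (Λ * t))))
    {t j : ℕ} (ht : 1 ≤ t) (hj : 1 ≤ j) (hN : 4 * (Λ ^ j * t) + 8 ≤ N)
    (hwin : ∀ s : ℕ, 1 ≤ s → s ≤ Λ ^ j * t → g s ≤ η) :
    g t ≤ max δ (1 / (b * j) ^ 2) := by
  have key := moebius_telescope hb hδ (fun i => g (Λ ^ i * t)) j hj ?_
  · simpa using key
  intro i hi
  -- one row at the scale `Λ^i t`
  have hpow : Λ ^ (i + 1) * t ≤ Λ ^ j * t :=
    Nat.mul_le_mul_right t (Nat.pow_le_pow_right hΛ (by omega))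
  have hmul : Λ * (Λ ^ i * t) = Λ ^ (i + 1) * t := by ring
  have h1 : 1 ≤ Λ ^ i * t := Nat.one_le_iff_ne_zero.2 (Nat.mul_ne_zero (pow_ne_zero _ (by omega)) (by omega))
  have h2 : 4 * (Λ * (Λ ^ i * t)) + 8 ≤ N := by
    rw [hmul]; exact le_trans (by omega) hN
  have h3 : ∀ s : ℕ, 1 ≤ s → s ≤ Λ * (Λ ^ i * t) → g s ≤ η := by
    intro s hs1 hs2
    rw [hmul] at hs2
    exact hwin s hs1 (hs2.trans hpow)
  have := hrow (Λ ^ i * t) h1 h2 h3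
  simpa only [hmul] using this

/-! ## §5 The intrinsic crossover index (proved) -/

section Crossover

open Classical in
/-- **The intrinsic crossover** `t_×(k)`: the least scale `s ≥ 1` fitting the torus (`4s + 8 ≤ N_k`) at which the on-axis coupling
exceeds `η`; `N_k + 1` if there is none. -/
def crossIdx (N : ℕ → ℕ) (g : ℕ → ℕ → ℝ) (η : ℝ) (k : ℕ) : ℕ :=
  if h : ∃ s : ℕ, 1 ≤ s ∧ 4 * s + 8 ≤ N k ∧ η < g k s then Nat.find h else N k + 1

open Classical in
theorem crossIdx_spec {N : ℕ → ℕ} {g : ℕ → ℕ → ℝ} {η : ℝ} {k : ℕ}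
    (h : ∃ s : ℕ, 1 ≤ s ∧ 4 * s + 8 ≤ N k ∧ η < g k s) :
    1 ≤ crossIdx N g η k ∧ 4 * crossIdx N g η k + 8 ≤ N k ∧ η < g k (crossIdx N g η k) := by
  unfold crossIdx
  rw [dif_pos h]
  exact Nat.find_spec h

open Classical in
theorem crossIdx_of_not {N : ℕ → ℕ} {g : ℕ → ℕ → ℝ} {η : ℝ} {k : ℕ}
    (h : ¬ ∃ s : ℕ, 1 ≤ s ∧ 4 * s + 8 ≤ N k ∧ η < g k s) : crossIdx N g η k = N k + 1 := by
  unfold crossIdx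
  rw [dif_neg h]

open Classical in
/-- **Below the crossover the window is `η`-small.** -/
theorem le_of_lt_crossIdx {N : ℕ → ℕ} {g : ℕ → ℕ → ℝ} {η : ℝ} {k s : ℕ} (hs1 : 1 ≤ s) (hsN : 4 * s + 8 ≤ N k)
    (hlt : s < crossIdx N g η k) : g k s ≤ η := by
  by_contra hgt
  have hgt' : η < g k s := not_le.1 hgt
  have h : ∃ s : ℕ, 1 ≤ s ∧ 4 * s + 8 ≤ N k ∧ η < g k s := ⟨s, hs1, hsN, hgt'⟩
  have hle : crossIdx N g η k ≤ s := by
    unfold crossIdx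
    rw [dif_pos h]
    exact Nat.find_min' h ⟨hs1, hsN, hgt'⟩
  exact absurd hlt (not_lt.2 hle)

end Crossover


/-! ## §6 The PROFILE LEMMA (proved)

Abstract real analysis over a sequence of lattices `k` with spacings `a_k → 0`, torus half-sides `N_k` (`a_k N_k → ∞`) and on-axis
couplings `g k t`: if the Möbius row (floor `δ`, eventually in `k`, for every `δ > 0`) and the crossover decay hold, then along a
sub-subsequence `ψ` (chosen ONCE, independent of `u`), for every `ε > 0` and every small enough `u > 0`, eventually `g (ψ k) t ≤ ε` at
every lattice scale `t` with `t a_{ψ k} ∈ [u/4, u]`.  Dichotomy on the physical crossover length `ℓ_k = a_k · t_×(k)`: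
CASE I (`ℓ_{ψ k} ≥ T₀ > 0`): the `u`-window sits `j` block steps below the crossover, the row telescope gives `max ε (1/(b j)²)`;
CASE II (`ℓ_k → 0`): the `u`-window lies `≥ M` crossover lengths past the crossover, the decay gives `ε`. -/

/-- **PROFILE LEMMA** (proved; the composition's engine). -/
theorem profile_window {a : ℕ → ℝ} {N : ℕ → ℕ} {g : ℕ → ℕ → ℝ} {Λ : ℕ} {b η : ℝ}
    (ha : ∀ k, 0 < a k) (ha0 : Tendsto a atTop (𝓝 0)) (hN : Tendsto (fun k => a k * (N k : ℝ)) atTop atTop)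
    (hΛ : 2 ≤ Λ) (hb : 0 < b)
    (hrow : ∀ δ : ℝ, 0 < δ → ∀ᶠ k in atTop, ∀ t : ℕ, 1 ≤ t → 4 * (Λ * t) + 8 ≤ N k →
      (∀ s : ℕ, 1 ≤ s → s ≤ Λ * t → g k s ≤ η) → g k t ≤ max δ (moebius b (g k (Λ * t))))
    (hdecay : ∀ ε : ℝ, 0 < ε → ∃ M : ℕ, ∀ᶠ k in atTop, ∀ s₀ s : ℕ, 1 ≤ s₀ → η < g k s₀ → M * s₀ ≤ s →
      4 * s + 8 ≤ N k → g k s ≤ ε) :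
    ∃ ψ : ℕ → ℕ, StrictMono ψ ∧ ∀ ε : ℝ, 0 < ε → ∃ u₀ : ℝ, 0 < u₀ ∧ ∀ u : ℝ, 0 < u → u < u₀ →
      ∀ᶠ k in atTop, ∀ t : ℕ, u / 4 ≤ (t : ℝ) * a (ψ k) → (t : ℝ) * a (ψ k) ≤ u → g (ψ k) t ≤ ε := by
  have hΛ0 : 0 < Λ := by omega
  have hΛr : (0 : ℝ) < (Λ : ℝ) := by exact_mod_cast hΛ0
  by_cases hI : ∃ T₀ : ℝ, 0 < T₀ ∧ ∃ᶠ k in atTop, T₀ ≤ a k * (crossIdx N g η k : ℝ)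
  · /- CASE I: along a subsequence the crossover stays at physical length `≥ T₀`; a `u`-window below `T₀/Λʲ` has `j` rows inside
       the intrinsic window above it, and the row telescope gives `g ≤ max ε (1/(b j)²) = ε`. -/
    obtain ⟨T₀, hT₀, hfreq⟩ := hI
    obtain ⟨ψ, hψ, hψT⟩ := extraction_of_frequently_atTop hfreq
    refine ⟨ψ, hψ, fun ε hε => ?_⟩
    -- the number of rows `j`, with `1/(b j)² < ε`
    obtain ⟨j, hj1, hjε⟩ : ∃ j : ℕ, 1 ≤ j ∧ 1 / (b * (j : ℝ)) ^ 2 < ε := by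
      obtain ⟨j₀, hj₀⟩ := exists_nat_gt (1 / (b ^ 2 * ε))
      refine ⟨j₀ + 1, by omega, ?_⟩
      have hbε : 0 < b ^ 2 * ε := mul_pos (pow_pos hb 2) hε
      have hj : (1 : ℝ) ≤ ((j₀ + 1 : ℕ) : ℝ) := by exact_mod_cast Nat.succ_le_succ (Nat.zero_le j₀)
      have hlt : 1 / (b ^ 2 * ε) < ((j₀ + 1 : ℕ) : ℝ) := hj₀.trans (by exact_mod_cast Nat.lt_succ_self j₀)
      have h1 : 1 < ((j₀ + 1 : ℕ) : ℝ) * (b ^ 2 * ε) := (div_lt_iff₀ hbε).1 hlt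
      have hj2 : ((j₀ + 1 : ℕ) : ℝ) ≤ ((j₀ + 1 : ℕ) : ℝ) ^ 2 := by nlinarith [hj]
      have hden : (0 : ℝ) < (b * ((j₀ + 1 : ℕ) : ℝ)) ^ 2 := pow_pos (mul_pos hb (by positivity)) 2
      rw [div_lt_iff₀ hden]
      calc (1 : ℝ) < ((j₀ + 1 : ℕ) : ℝ) * (b ^ 2 * ε) := h1
        _ ≤ ((j₀ + 1 : ℕ) : ℝ) ^ 2 * (b ^ 2 * ε) := mul_le_mul_of_nonneg_right hj2 hbε.le
        _ = ε * (b * ((j₀ + 1 : ℕ) : ℝ)) ^ 2 := by ring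
    have hΛpos : (0 : ℝ) < (Λ : ℝ) ^ j := pow_pos hΛr j
    refine ⟨T₀ / (Λ : ℝ) ^ j, div_pos hT₀ hΛpos, fun u hu huu₀ => ?_⟩
    have hψt : Tendsto ψ atTop atTop := hψ.tendsto_atTop
    have E1 : ∀ᶠ k in atTop, ∀ t : ℕ, 1 ≤ t → 4 * (Λ * t) + 8 ≤ N (ψ k) →
        (∀ s : ℕ, 1 ≤ s → s ≤ Λ * t → g (ψ k) s ≤ η) → g (ψ k) t ≤ max ε (moebius b (g (ψ k) (Λ * t))) :=
      hψt.eventually (hrow ε hε)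
    have E2 : ∀ᶠ k in atTop, a (ψ k) < 1 := (tendsto_order.1 (ha0.comp hψt)).2 1 one_pos
    have E3 : ∀ᶠ k in atTop, 4 * T₀ + 8 ≤ a (ψ k) * (N (ψ k) : ℝ) :=
      (hN.comp hψt).eventually (eventually_ge_atTop _)
    filter_upwards [E1, E2, E3] with k hrowk ha1 haN t hw1 hw2
    have hak := ha (ψ k)
    -- `t ≥ 1`
    have ht : 1 ≤ t := by
      rcases Nat.eq_zero_or_pos t with h | h
      · exfalso
        subst h
        rw [Nat.cast_zero, zero_mul] at hw1
        linarith
      · exact h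
    -- the top of the ladder `Λʲ t` lies below the crossover and fits the torus
    have hP : a (ψ k) * ((Λ ^ j * t : ℕ) : ℝ) < T₀ := by
      have h1 : a (ψ k) * ((Λ ^ j * t : ℕ) : ℝ) = (Λ : ℝ) ^ j * ((t : ℝ) * a (ψ k)) := by push_cast; ring
      rw [h1]
      calc (Λ : ℝ) ^ j * ((t : ℝ) * a (ψ k)) ≤ (Λ : ℝ) ^ j * u := mul_le_mul_of_nonneg_left hw2 hΛpos.le
        _ < (Λ : ℝ) ^ j * (T₀ / (Λ : ℝ) ^ j) := mul_lt_mul_of_pos_left huu₀ hΛpos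
        _ = T₀ := by field_simp
    have hlt : Λ ^ j * t < crossIdx N g η (ψ k) := by
      have h := lt_of_mul_lt_mul_left (hP.trans_le (hψT k)) hak.le
      exact_mod_cast h
    have hNk : 4 * (Λ ^ j * t) + 8 ≤ N (ψ k) := by
      have h1 : a (ψ k) * ((4 * (Λ ^ j * t) + 8 : ℕ) : ℝ) < a (ψ k) * (N (ψ k) : ℝ) := by
        have h2 : a (ψ k) * ((4 * (Λ ^ j * t) + 8 : ℕ) : ℝ) =
            4 * (a (ψ k) * ((Λ ^ j * t : ℕ) : ℝ)) + 8 * a (ψ k) := by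
          push_cast; ring
        rw [h2]
        linarith
      have h3 := lt_of_mul_lt_mul_left h1 hak.le
      exact_mod_cast h3.le
    have hwin : ∀ s : ℕ, 1 ≤ s → s ≤ Λ ^ j * t → g (ψ k) s ≤ η := by
      intro s hs1 hs2
      refine le_of_lt_crossIdx hs1 ?_ (lt_of_le_of_lt hs2 hlt)
      have := Nat.mul_le_mul_left 4 hs2
      omega
    have hΛ1 : 1 ≤ Λ := by omega
    have := row_telescope hΛ1 hb hε.le hrowk ht hj1 hNk hwin
    exact this.trans (max_le le_rfl hjε.le)
  · /- CASE II: the crossover length tends to `0`; every `u`-window lies `≥ M` crossover lengths past the crossover: decay. -/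
    have hII : ∀ T₀ : ℝ, 0 < T₀ → ∀ᶠ k in atTop, a k * (crossIdx N g η k : ℝ) < T₀ := by
      intro T₀ hT₀
      have h1 : ¬ ∃ᶠ k in atTop, T₀ ≤ a k * (crossIdx N g η k : ℝ) := fun hf => hI ⟨T₀, hT₀, hf⟩
      simpa only [Filter.not_frequently, not_le] using h1
    refine ⟨id, strictMono_id, fun ε hε => ?_⟩
    obtain ⟨M, hM⟩ := hdecay ε hε
    refine ⟨1, one_pos, fun u hu _ => ?_⟩
    have hM0 : (0 : ℝ) ≤ (M : ℝ) := Nat.cast_nonneg M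
    have hM1 : (0 : ℝ) < (M : ℝ) + 1 := by positivity
    have D2 : ∀ᶠ k in atTop, a k * (crossIdx N g η k : ℝ) < u / (4 * ((M : ℝ) + 1)) :=
      hII _ (div_pos hu (by positivity))
    have D3 : ∀ᶠ k in atTop, a k < u / 4 := (tendsto_order.1 ha0).2 (u / 4) (by linarith)
    have D4 : ∀ᶠ k in atTop, 6 * u ≤ a k * (N k : ℝ) := hN.eventually (eventually_ge_atTop _)
    have key : ∀ᶠ k in atTop, ∀ t : ℕ, u / 4 ≤ (t : ℝ) * a k → (t : ℝ) * a k ≤ u → g k t ≤ ε := by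
      filter_upwards [hM, D2, D3, D4] with k hMk hℓ hak haN t hw1 hw2
      have hak0 := ha k
      -- the crossover exists (else `ℓ_k = a_k (N_k + 1) > a_k N_k ≥ 6u`)
      have hex : ∃ s : ℕ, 1 ≤ s ∧ 4 * s + 8 ≤ N k ∧ η < g k s := by
        by_contra hne
        rw [crossIdx_of_not hne] at hℓ
        have h1 : a k * (N k : ℝ) ≤ a k * ((N k + 1 : ℕ) : ℝ) := by push_cast; nlinarith
        have h2 : u / (4 * ((M : ℝ) + 1)) ≤ u := by
          rw [div_le_iff₀ (by positivity)]
          nlinarith [mul_nonneg hu.le hM0]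
        linarith
      obtain ⟨hc1, hcN, hcη⟩ := crossIdx_spec (g := g) hex
      -- `M · t_× ≤ t`: `M t_× a ≤ (M+1) ℓ < u/4 ≤ t a`
      have hMc : M * crossIdx N g η k ≤ t := by
        have h1 : ((M * crossIdx N g η k : ℕ) : ℝ) * a k < (t : ℝ) * a k := by
          have h2 : ((M * crossIdx N g η k : ℕ) : ℝ) * a k ≤ ((M : ℝ) + 1) * (a k * (crossIdx N g η k : ℝ)) := by
            push_cast
            have : (0 : ℝ) ≤ a k * (crossIdx N g η k : ℝ) := mul_nonneg hak0.le (Nat.cast_nonneg _)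
            nlinarith
          have h3 : ((M : ℝ) + 1) * (a k * (crossIdx N g η k : ℝ)) < ((M : ℝ) + 1) * (u / (4 * ((M : ℝ) + 1))) :=
            mul_lt_mul_of_pos_left hℓ hM1
          have h4 : ((M : ℝ) + 1) * (u / (4 * ((M : ℝ) + 1))) = u / 4 := by
            field_simp
          linarith
        have h5 := lt_of_mul_lt_mul_right h1 hak0.le
        exact_mod_cast h5.le
      -- `4t + 8 ≤ N_k`: `a (4t + 8) ≤ 4u + 8a < 6u ≤ a N`
      have htN : 4 * t + 8 ≤ N k := by
        have h1 : a k * ((4 * t + 8 : ℕ) : ℝ) < a k * (N k : ℝ) := by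
          have h2 : a k * ((4 * t + 8 : ℕ) : ℝ) = 4 * ((t : ℝ) * a k) + 8 * a k := by push_cast; ring
          rw [h2]
          linarith
        have h3 := lt_of_mul_lt_mul_left h1 hak0.le
        exact_mod_cast h3.le
      exact hMk _ t hc1 hcη hMc htN
    exact key

/-! ## §7 Composition (kernel-checked, 0 sorry): the three stubs prove the crux BY NAME

`MoebiusRow → CrossoverDecay → LatticeToAxis → F4SubCurvatureDoor.SubCurvatureClause`: instantiate §6 along the leg scheme
(`β_k → ∞` turns `∃ β₁ ∀ β ≥ β₁` into `∀ᶠ k`), pass to the sub-subsequence `φ ∘ ψ` (off-diagonal limits are stable), feed the window bound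
to `LatticeToAxis` at `θ = 1/2` (constant `3⁸ = 6561`) to get the clause ON THE TIME AXIS, and conclude by the LANDED axis reduction
(✓`axisReduction`, frs-p2 g19) whose two structural inputs are tree theorems for the door's kernels: signed-permutation invariance of `K`
(King faithfulness ✓`faithful_of_kernel` + the `W(B₄)` rung ✓`signedPerm_invariant_of_offDiagLimitAlong`) and pointwise OS-positivity
(✓`pointwise_rp_of_offDiagLimitAlong`). -/

section Composition

variable {G : Type} [Group G] [TopologicalSpace G] [IsTopologicalGroup G] [CompactSpace G]
  [MeasurableSpace G] [BorelSpace G]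

/-- Off-diagonal limits are stable under passing to a further subsequence. -/
theorem offDiagLimitAlong_comp (r : LatticeRep G) {sch : SpeciesScheme (YMSpecies G)} {φ : ℕ → ℕ}
    {S₁ : SchwingerFamily E4} (hS₁ : OffDiagLimitAlong r sch φ S₁) {ψ : ℕ → ℕ} (hψ : Tendsto ψ atTop atTop) :
    OffDiagLimitAlong r sch (φ ∘ ψ) S₁ :=
  ⟨hS₁.1, hS₁.2.1, fun n hn F hF => (hS₁.2.2 n hn F hF).comp hψ⟩

end Composition

-- REGISTRATION PLUMBING (cruxplan g0, 2026-08-30; no mathematical content): the curried composition below is `private` — an AUXILIARY of this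
-- file; the skeleton theorem that concludes the crux BY NAME from the declared stubs is `SubCurvatureClause_of_rpMoebiusLadder` (last theorem).

/-- ★ **COMPOSITION.**  The Möbius row, the crossover decay and the on-axis density transfer prove the sub-curvature clause of route
`F4SubCurvatureDoor`, by name. -/
private theorem SubCurvatureClause_of (hRow : MoebiusRow) (hDecay : CrossoverDecay) (hL2A : LatticeToAxis) :
    Summit.QuantumFields.YangMills.Theses.F4SubCurvatureDoor.SubCurvatureClause := by
  intro G _ _ _ _ hG
  letI : MeasurableSpace G := borel G
  haveI : BorelSpace G := ⟨rfl⟩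
  intro r a hapos ha0 hMB sch hsch φ hφ S₁ hS₁ K hKc hrep
  -- (1) the row and the decay along the subsequence (`β_k → ∞`)
  obtain ⟨Λ, b, η, hΛ, hb, hη, hrow⟩ := hRow G hG r
  have hβ : Tendsto (fun k => sch.β (φ k)) atTop atTop := hsch.2.1.comp hφ
  have ha' : ∀ k, 0 < sch.a (φ k) := fun k => sch.a_pos _
  have ha0' : Tendsto (fun k => sch.a (φ k)) atTop (𝓝 0) := sch.tendsto_a.comp hφ
  have hN' : Tendsto (fun k => sch.a (φ k) * (sch.L (φ k) : ℝ)) atTop atTop := sch.tendsto_L.comp hφ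
  have hrow' : ∀ δ : ℝ, 0 < δ → ∀ᶠ k in atTop, ∀ t : ℕ, 1 ≤ t → 4 * (Λ * t) + 8 ≤ sch.L (φ k) →
      (∀ s : ℕ, 1 ≤ s → s ≤ Λ * t → axisGs r (sch.β (φ k)) (sch.L (φ k)) s ≤ η) →
        axisGs r (sch.β (φ k)) (sch.L (φ k)) t ≤ max δ (moebius b (axisGs r (sch.β (φ k)) (sch.L (φ k)) (Λ * t))) := by
    intro δ hδ
    obtain ⟨β₁, hβ₁⟩ := hrow δ hδ
    filter_upwards [hβ.eventually (eventually_ge_atTop β₁)] with k hk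
    exact fun t ht hL hw => hβ₁ _ hk _ t ht hL hw
  have hdecay' : ∀ ε : ℝ, 0 < ε → ∃ M : ℕ, ∀ᶠ k in atTop, ∀ s₀ s : ℕ, 1 ≤ s₀ →
      η < axisGs r (sch.β (φ k)) (sch.L (φ k)) s₀ → M * s₀ ≤ s → 4 * s + 8 ≤ sch.L (φ k) →
        axisGs r (sch.β (φ k)) (sch.L (φ k)) s ≤ ε := by
    intro ε hε
    obtain ⟨M, β₁, hβ₁⟩ := hDecay G hG r η hη ε hε
    refine ⟨M, ?_⟩
    filter_upwards [hβ.eventually (eventually_ge_atTop β₁)] with k hk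
    exact fun s₀ s h1 h2 h3 h4 => hβ₁ _ hk _ s₀ s h1 h2 h3 h4
  -- (2) the profile lemma: a sub-subsequence `φ ∘ ψ` with small on-axis coupling in every small `u`-window
  obtain ⟨ψ, hψ, hprof⟩ := profile_window (g := fun k t => axisGs r (sch.β (φ k)) (sch.L (φ k)) t)
    ha' ha0' hN' hΛ hb hrow' hdecay'
  have hψt : Tendsto ψ atTop atTop := hψ.tendsto_atTop
  have hφ' : Tendsto (φ ∘ ψ) atTop atTop := hφ.comp hψt
  have hS₁' : OffDiagLimitAlong r sch (φ ∘ ψ) S₁ := offDiagLimitAlong_comp r hS₁ hψt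
  -- (3) the clause ON THE TIME AXIS, through `LatticeToAxis` at `θ = 1/2` along `φ ∘ ψ`
  have haxis : Tendsto (fun t : ℝ => t ^ 8 * K (EuclideanSpace.single 0 t)) (𝓝[>] 0) (𝓝 0) := by
    rw [Metric.tendsto_nhdsWithin_nhds]
    intro ε hε
    obtain ⟨u₀, hu₀, hu⟩ := hprof (ε / (2 * 6561)) (div_pos hε (by norm_num))
    refine ⟨u₀, hu₀, fun u hu_pos hu_dist => ?_⟩
    have hu0 : 0 < u := hu_pos
    have huu₀ : u < u₀ := by
      rw [dist_zero_right, Real.norm_eq_abs, abs_of_pos hu0] at hu_dist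
      exact hu_dist
    have hwin : ∀ᶠ k in atTop, ∀ t : ℕ, u * (1 - 1 / 2) ≤ 2 * t * sch.a ((φ ∘ ψ) k) →
        2 * t * sch.a ((φ ∘ ψ) k) ≤ u * (1 + 1 / 2) →
          axisG r (sch.β ((φ ∘ ψ) k)) (sch.L ((φ ∘ ψ) k)) t ≤ ε / (2 * 6561) ∧
          axisG' r (sch.β ((φ ∘ ψ) k)) (sch.L ((φ ∘ ψ) k)) t ≤ ε / (2 * 6561) := by
      filter_upwards [hu u hu0 huu₀] with k hk t h1 h2
      simp only [Function.comp_apply] at h1 h2 ⊢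
      exact max_le_iff.1 (hk t (by linarith) (by linarith))
    have hB := hL2A G hG r a hapos ha0 hMB sch hsch (φ ∘ ψ) hφ' S₁ hS₁' K hKc hrep u (1 / 2) (ε / (2 * 6561))
      hu0 (by norm_num) (by norm_num) (le_of_lt (div_pos hε (by norm_num))) hwin
    have h6561 : (1 + 1 / 2 : ℝ) ^ 8 / (1 - 1 / 2) ^ 8 = 6561 := by norm_num
    rw [h6561] at hB
    rw [dist_zero_right, Real.norm_eq_abs, abs_mul, abs_of_nonneg (by positivity : (0 : ℝ) ≤ u ^ 8)]
    have habs : 0 ≤ |K (EuclideanSpace.single 0 u)| := abs_nonneg _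
    have h13122 : (6561 : ℝ) * (ε / (2 * 6561)) = ε / 2 := by ring
    linarith
  -- (4) signed-permutation invariance of `K` (King faithfulness + the `W(B₄)` rung), pointwise RP, and the AXIS REDUCTION (all tree)
  have hinv : ∀ R : E4 ≃ₗᵢ[ℝ] E4,
      (∀ i : Fin 4, ∃ j : Fin 4, R (EuclideanSpace.single i 1) = EuclideanSpace.single j 1 ∨
        R (EuclideanSpace.single i 1) = -EuclideanSpace.single j 1) → ∀ x : E4, K (R x) = K x := by
    intro R hR x
    by_cases hx : x = 0
    · subst hx; simp
    · have hpos : 0 < ‖x‖ + 1 := by positivity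
      exact ((Theorems.F4SubCurvatureDoorSubCurvatureKernelFaithful.faithful_of_kernel K hKc (S₁ 2) hrep (‖x‖ + 1) hpos R).1
        (fun F hF => Theorems.CheckerboardTrialityHyperoctahedral.signedPerm_invariant_of_offDiagLimitAlong r hapos ha0 hMB
          hsch hφ hS₁ R hR 2 F hF.1)) x hx (by linarith)
  have hRP := Theorems.F4SubCurvatureDoorSubCurvatureKernelPointwiseRP.pointwise_rp_of_offDiagLimitAlong r hapos ha0 hMB hsch
    hφ hS₁ K hKc hrep
  exact Theorems.F4SubCurvatureDoorSubCurvatureClauseAxisReduction.axisReduction K hKc hinv hRP haxis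

/-- ★ **THE LINE CONCLUDES THE CRUX BY NAME**: the three registered stubs prove `F4SubCurvatureDoor.SubCurvatureClause`
⟨stmt-QuantumFields-23763⟩ (the only `sorry`s are inside `stub_moebiusRow`, `stub_crossoverDecay`, `stub_latticeToAxis`). -/
theorem SubCurvatureClause_of_rpMoebiusLadder :
    Summit.QuantumFields.YangMills.Theses.F4SubCurvatureDoor.SubCurvatureClause :=
  SubCurvatureClause_of stub_moebiusRow stub_crossoverDecay stub_latticeToAxis

end Summit.QuantumFields.YangMills.Cruxes.SubCurvatureClause.RpMoebiusLadder

end
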